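import Literature.Computability.AlgebraicComplexity.DDS21WedgeWedgeClass
import Literature.Computability.AlgebraicComplexity.DDS21DeborderReadOnce
import Literature.Computability.AlgebraicComplexity.DDS21DeborderPiSigmaWedgeProofs
import HarnessLib

/-!
# Dutta–Dwivedi–Saxena 2021, Lemma 2.17 / Lemma 2.23 for `Σ∧Σ∧`: the read-once form and
# de-bordering (`\overline{Σ∧Σ∧} ⊆ ARO ⊆ ABP`), and the `k = 1` base of Thm. 5.1

Theorem-only companion (cell `val-lit`, row X2-DDS21, brick **B6-2** of
`HOME/np/MEMO-p1g10-DDS21-B6-Thm51-sizing.md`; RULINGS (143)(a), (146)(b)) of t20's class file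
`DDS21WedgeWedgeClass.lean` (B6-0: `wedgeForm a p = C a + ∑_m p_m(x_m)`, `swswClass K n t e δ` =
`Σ∧Σ∧(t, e, δ)`), of B2 `DDS21DepthThreeDiagonalToolkit.lean` (§6, the `Σ∧Σ` duality step) and of
B2b `DDS21DeborderReadOnce.lean` (Lemmas 2.22/2.23 for the explicit read-once input). Source:
P. Dutta, P. Dwivedi, N. Saxena, *Demystifying the border of depth-3 algebraic circuits*, FOCS 2021,
full version `paper:galaxy-pdf-7641649743695546420` [DuttaDwivediSaxena2022]:
**Lemma 2.16** (duality trick, p0022 L586–592), **Lemma 2.17** ("`Σ∧Σ∧` as ARO … Let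
`g^e = (g_1(x_1) + ⋯ + g_n(x_n))^e`, where `deg(g_i) · e ≤ D` … `g^e = ∑_{i=1}^{O(ne)} h_{i1}(x_1) ⋯
h_{in}(x_n)`, where each `h_{ij}` is of degree at most `D`", p0022 L593–603), **Lemma 2.23**
("De-bordering `Σ∧Σ∧`. Consider a polynomial `f ∈ F[x]` which is approximated by `Σ∧Σ∧` of size
`s` over `F(ε)[x]`, and the syntactic degree of the circuit is `D`. Then there exists an ARO of size
`O(s n² D²)` which exactly computes `f(x)`", p0025 L661–664), and **Thm. 5.1**, `k = 1`
("`\overline{ΠΣ∧} = ΠΣ∧`", Lemma 2.21, p0024 L633–640; proof sketch p0044 L1155–1158).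

## Contents (no definitions, no named facts; everything PROVED)

* §1 **Lemma 2.17 for `Σ∧Σ∧` with budgets** (characteristic zero): `wedgePow_eq_sum_prod_univariate`
  — one power `(a + ∑_m p_m(x_m))^W`, `deg p_m ≤ δ`, is a sum of `(n+1)·W + 1` terms
  `κ · ∏_m h_m(x_m)` with `deg h_m ≤ W·δ` (Saxena's duality `DepthThreeChasm.duality` on the `n + 1`
  summands `a`, `p_m(x_m)`; `h_m = E_W(u · p_m)` with the truncated exponential `E_W`); hence
  ★ `exists_sum_prod_univariate_of_mem_swswClass` — every `f ∈ Σ∧Σ∧(t, e, δ)` is a sum of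
  `t · ((n+1)e + 1)` products of univariates of degree `≤ e·δ` (print: top fan-in `O(sne)`, degree
  `≤ D`). This is EXACTLY the input shape of B2b's de-bordering.
* §2 **Lemma 2.23 for `Σ∧Σ∧` (`\overline{Σ∧Σ∧} ⊆ ARO ⊆ ABP`)**: `exists_transfer_of_mem_border_swswClass`
  (read-once oblivious program over `F` of width `t·((n+1)e+1)`, univariate labels of degree `≤ e·δ`,
  via B2b `exists_transfer_of_isEpsApprox_sum_prod_univariate`), ★ `uabpComputes_of_mem_border_swswClass`
  (`UABPComputes ((n+1)·t((n+1)e+1) + e·δ + 2) f`, via B2b `uabpComputes_of_isEpsApprox_sum_prod_univariate`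
  BY NAME), `uabpComputesLen_of_mem_border_swswClass` (length `n + 2`), the one-parameter forms
  `…_le` (`t, e, δ, n ≤ s`, `2 ≤ s` ⇒ budget `s⁷`), and the exact-member corollaries
  `UABPComputesLen.of_wedgeForm` / `UABPComputesLen.of_mem_swswClass` (`Σ∧Σ∧ ⊆ ABP` directly, no
  duality) / `uabpComputes_of_mem_swswClass`.
* §3 **The `k = 1` base of Thm. 5.1, PROVED**: `UABPComputesLen.of_mem_spswClass` (`Σ^{[k]}ΠΣ∧`
  circuits have small ABPs) and ★ `uabpComputes_of_mem_border_spswClass_one` — with the tree's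
  `DDS2021_lemma_2_21_holds` (`\overline{ΠΣ∧} = ΠΣ∧`, `DDS21DeborderPiSigmaWedgeProofs.lean`):
  `f ∈ border (spswClass (RatFunc F) n 1 d e)`, `d, e, n ≤ s`, `2 ≤ s` ⇒ `UABPComputes (s⁶) f`.
  Together with §2 this is the complete base step of the bloated model
  `(ΠΣ∧/ΠΣ∧)·(Σ∧Σ∧/Σ∧Σ∧)` of §5 in the tree's ABP currency.

Deviations / scope (disclosed, as in B2b): identity variable order and WIDTH bookkeeping for the
ARO; budgets `(t, e, δ)` instead of the printed size `s` and syntactic degree `D ≥ e·δ`;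
coefficients in a FIELD of characteristic zero approximated over `F(ε) = RatFunc F` (the tree's
`DDS2021.border` / `MS2021.IsEpsApprox`).

Honest framing: de-bordering of a restricted read-once class and a `k = 1` base case, banked
toward the x-row `DDS2021_thm_5_1` (which remains OPEN by name, as does `DDS2021_thm_3_2`);
`VP ≠ VNP` is NOT proved and nothing here bears on it.

## References

* [DuttaDwivediSaxena2022] P. Dutta, P. Dwivedi, N. Saxena, *Demystifying the border of depth-3
  algebraic circuits*, Proc. 62nd FOCS (2021), IEEE 2022, 92–103; full version Lemmas 2.16, 2.17
  (p0022 L586–603), 2.21 (p0024 L633–640), 2.22 (p0024 L644–660), 2.23 (p0025 L661–664); Thm. 5.1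
  with its proof sketch (p0043 L1144 – p0045 L1).
* [GuptaKamathKayalSaptharishi2016] duality trick as proved in the tree (`DepthThreeChasm.duality`).
-/

noncomputable section

open MvPolynomial
open scoped BigOperators Matrix

namespace Literature.Computability.AlgebraicComplexity

namespace DDS2021

/-! ## §1 Lemma 2.17 for `Σ∧Σ∧`: sums of products of univariates (Saxena's duality trick) -/

section Duality

variable {K : Type*} [Field K] {n : ℕ}

/-- The truncated exponential of a univariate, `E_W(u · q) = ∑_{j ≤ W} (u^j / j!) q^j`, has degree
`≤ W · deg q`. [folklore] -/
private theorem natDegree_truncExp_comp_le (W : ℕ) (u : K) {q : Polynomial K} {δ : ℕ}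
    (hq : q.natDegree ≤ δ) :
    (∑ j ∈ Finset.range (W + 1),
        Polynomial.C ((((j.factorial : ℕ) : K)⁻¹) * u ^ j) * q ^ j).natDegree ≤ W * δ := by
  refine Polynomial.natDegree_sum_le_of_forall_le _ _ fun j hj => ?_
  refine (Polynomial.natDegree_C_mul_le _ _).trans ((Polynomial.natDegree_pow_le).trans ?_)
  exact Nat.mul_le_mul (Nat.le_of_lt_succ (Finset.mem_range.1 hj)) hq

/-- The truncated exponential of a univariate, evaluated at `x_m`:
`∑_{j ≤ W} (u^j / j!) · (q(x_m))^j = (E_W(u · q))(x_m)`. [folklore] -/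
private theorem truncExp_aeval_X_eq (W : ℕ) (u : K) (q : Polynomial K) (m : Fin n) :
    ∑ j ∈ Finset.range (W + 1),
        algebraMap K (MvPolynomial (Fin n) K) ((((j.factorial : ℕ) : K)⁻¹) * u ^ j) *
          (Polynomial.aeval (X m : MvPolynomial (Fin n) K) q) ^ j =
      Polynomial.aeval (X m : MvPolynomial (Fin n) K)
        (∑ j ∈ Finset.range (W + 1), Polynomial.C ((((j.factorial : ℕ) : K)⁻¹) * u ^ j) * q ^ j) := by
  rw [map_sum]
  refine Finset.sum_congr rfl fun j _ => ?_
  simp only [map_mul, map_pow, Polynomial.aeval_C]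

/-- **DDS21 Lemma 2.17, one power** ("We first show how to compute `g^e` by ARO … we do this for
each power (i.e. each summand of `f`) individually"): over a field of characteristic zero, for a
`Σ∧` form `g = a + ∑_{m<n} p_m(x_m)` with `deg p_m ≤ δ`,
`g^W = ∑_{u ≤ (n+1)W} κ_u · ∏_m h_{u,m}(x_m)` with univariate `h_{u,m}` of degree `≤ W·δ` — Saxena's
duality trick (Lemma 2.16; tree `DepthThreeChasm.duality` on the `n + 1` summands `a`, `p_m(x_m)`,
nodes `0, …, (n+1)W`), `h_{u,m} = E_W(u · p_m)` the truncated exponential, the constant summand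
contributing the scalar `E_W(u · a)`.
[cite: DuttaDwivediSaxena2022, Lemma 2.16 and Lemma 2.17 (full version p0022 L586–603)] -/
theorem wedgePow_eq_sum_prod_univariate [CharZero K] (a : K) {p : Fin n → Polynomial K} {δ : ℕ}
    (hp : ∀ m, (p m).natDegree ≤ δ) (W : ℕ) :
    ∃ (κ : Fin ((n + 1) * W + 1) → K) (h : Fin ((n + 1) * W + 1) → Fin n → Polynomial K),
      (∀ u m, (h u m).natDegree ≤ W * δ) ∧
        wedgeForm a p ^ W =
          ∑ u, C (κ u) * ∏ m, Polynomial.aeval (X m : MvPolynomial (Fin n) K) (h u m) := by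
  classical
  set N : ℕ := (n + 1) * W with hN
  obtain ⟨β, hβ⟩ := DepthThreeChasm.exists_dual_weights (K := K) N W
  -- the scalar `E_W(u · a)` and the univariates `E_W(u · p_m)`
  let κ0 : Fin (N + 1) → K := fun u =>
    ∑ j ∈ Finset.range (W + 1), (((j.factorial : ℕ) : K)⁻¹) * ((u : ℕ) : K) ^ j * a ^ j
  let h : Fin (N + 1) → Fin n → Polynomial K := fun u m =>
    ∑ j ∈ Finset.range (W + 1),
      Polynomial.C ((((j.factorial : ℕ) : K)⁻¹) * ((u : ℕ) : K) ^ j) * p m ^ j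
  refine ⟨fun u => β u * κ0 u, h, fun u m => natDegree_truncExp_comp_le W _ (hp m), ?_⟩
  -- Saxena's duality for the `n + 1` summands of the `Σ∧` form
  let y : Option (Fin n) → MvPolynomial (Fin n) K := fun v =>
    Option.elim v (C a) fun m => Polynomial.aeval (X m : MvPolynomial (Fin n) K) (p m)
  have hcard : Fintype.card (Option (Fin n)) * W ≤ N := by
    rw [Fintype.card_option, Fintype.card_fin, hN]
  have hdual := DepthThreeChasm.duality (R := MvPolynomial (Fin n) K) hcard hβ y
  have hsum : ∑ v, y v = wedgeForm a p := by
    rw [Fintype.sum_option, wedgeForm_eq]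
    simp only [y, Option.elim]
  rw [← hsum, ← hdual]
  refine Finset.sum_congr rfl fun u _ => ?_
  rw [Fintype.prod_option]
  have hnone : (∑ j ∈ Finset.range (W + 1),
      algebraMap K (MvPolynomial (Fin n) K) ((((j.factorial : ℕ) : K)⁻¹) * ((u : ℕ) : K) ^ j) *
        y none ^ j) = C (κ0 u) := by
    simp only [y, Option.elim, κ0, map_sum, C_mul, C_pow, algebraMap_eq]
  have hsome : ∀ m : Fin n, (∑ j ∈ Finset.range (W + 1),
      algebraMap K (MvPolynomial (Fin n) K) ((((j.factorial : ℕ) : K)⁻¹) * ((u : ℕ) : K) ^ j) *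
        y (some m) ^ j) = Polynomial.aeval (X m : MvPolynomial (Fin n) K) (h u m) := by
    intro m
    simp only [y, Option.elim, h]
    exact truncExp_aeval_X_eq W ((u : ℕ) : K) (p m) m
  rw [hnone, Finset.prod_congr rfl fun m _ => hsome m, algebraMap_eq, C_mul]
  ring

/-- ★ **DDS21 Lemma 2.17 for `Σ∧Σ∧` (sum of products of univariates), with budgets.** Over a field of
characteristic zero, every `f ∈ Σ∧Σ∧(t, e, δ)` in `x_0, …, x_{n-1}` (t20's `swswClass K n t e δ`:
`f = ∑_{i<t} c_i · (a_i + ∑_m p_{im}(x_m))^{e_i}`, `e_i ≤ e`, `deg p_{im} ≤ δ`) is a sum of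
`t · ((n+1)·e + 1)` terms `κ · ∏_{m<n} h_m(x_m)` with univariate `h_m` of degree `≤ e·δ`
(print: "`g^e = ∑_{i=1}^{O(ne)} h_{i1}(x_1) ⋯ h_{in}(x_n)`, where each `h_{ij}` is of degree at most
`D` … for `Σ∧Σ∧` … top fan-in `O(sne)`"). Each power separately by `wedgePow_eq_sum_prod_univariate`
(uniform node count `(n+1)e`, padding the smaller exponents). This is exactly the input shape of
B2b's `exists_transfer_of_isEpsApprox_sum_prod_univariate` / `uabpComputes_of_isEpsApprox_sum_prod_univariate`.
[cite: DuttaDwivediSaxena2022, Lemma 2.16 and Lemma 2.17 (full version p0022 L586–603)] -/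
theorem exists_sum_prod_univariate_of_mem_swswClass [CharZero K] {t e δ : ℕ}
    {f : MvPolynomial (Fin n) K} (hf : f ∈ swswClass K n t e δ) :
    ∃ (κ : Fin t × Fin ((n + 1) * e + 1) → K)
      (g : Fin t × Fin ((n + 1) * e + 1) → Fin n → Polynomial K),
      (∀ q m, (g q m).natDegree ≤ e * δ) ∧
        f = ∑ q, C (κ q) * ∏ m, Polynomial.aeval (X m : MvPolynomial (Fin n) K) (g q m) := by
  classical
  obtain ⟨c, a, p, ex, hex, hp, rfl⟩ := hf
  set N : ℕ := (n + 1) * e with hN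
  choose β hβ using fun i : Fin t => DepthThreeChasm.exists_dual_weights (K := K) N (ex i)
  let κ0 : Fin t → Fin (N + 1) → K := fun i u =>
    ∑ j ∈ Finset.range (ex i + 1), (((j.factorial : ℕ) : K)⁻¹) * ((u : ℕ) : K) ^ j * a i ^ j
  let g : Fin t × Fin (N + 1) → Fin n → Polynomial K := fun q m =>
    ∑ j ∈ Finset.range (ex q.1 + 1),
      Polynomial.C ((((j.factorial : ℕ) : K)⁻¹) * ((q.2 : ℕ) : K) ^ j) * p q.1 m ^ j
  refine ⟨fun q => c q.1 * β q.1 q.2 * κ0 q.1 q.2, g, fun q m => ?_, ?_⟩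
  · exact (natDegree_truncExp_comp_le (ex q.1) _ (hp q.1 m)).trans (Nat.mul_le_mul_right _ (hex q.1))
  · rw [Fintype.sum_prod_type]
    refine Finset.sum_congr rfl fun i _ => ?_
    -- Saxena's duality for the `n + 1` summands of the `i`-th `Σ∧` form
    let y : Option (Fin n) → MvPolynomial (Fin n) K := fun v =>
      Option.elim v (C (a i)) fun m => Polynomial.aeval (X m : MvPolynomial (Fin n) K) (p i m)
    have hcard : Fintype.card (Option (Fin n)) * ex i ≤ N := by
      rw [Fintype.card_option, Fintype.card_fin, hN]
      exact Nat.mul_le_mul_left _ (hex i)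
    have hdual := DepthThreeChasm.duality (R := MvPolynomial (Fin n) K) hcard (hβ i) y
    have hsum : ∑ v, y v = wedgeForm (a i) (p i) := by
      rw [Fintype.sum_option, wedgeForm_eq]
      simp only [y, Option.elim]
    rw [← hsum, ← hdual, Finset.mul_sum]
    refine Finset.sum_congr rfl fun u _ => ?_
    rw [Fintype.prod_option]
    have hnone : (∑ j ∈ Finset.range (ex i + 1),
        algebraMap K (MvPolynomial (Fin n) K) ((((j.factorial : ℕ) : K)⁻¹) * ((u : ℕ) : K) ^ j) *
          y none ^ j) = C (κ0 i u) := by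
      simp only [y, Option.elim, κ0, map_sum, C_mul, C_pow, algebraMap_eq]
    have hsome : ∀ m : Fin n, (∑ j ∈ Finset.range (ex i + 1),
        algebraMap K (MvPolynomial (Fin n) K) ((((j.factorial : ℕ) : K)⁻¹) * ((u : ℕ) : K) ^ j) *
          y (some m) ^ j) = Polynomial.aeval (X m : MvPolynomial (Fin n) K) (g (i, u) m) := by
      intro m
      simp only [y, Option.elim, g]
      exact truncExp_aeval_X_eq (ex i) ((u : ℕ) : K) (p i m) m
    rw [hnone, Finset.prod_congr rfl fun m _ => hsome m, algebraMap_eq, C_mul, C_mul]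
    ring

end Duality

/-! ## §2 Lemma 2.23 for `Σ∧Σ∧`: de-bordering (`\overline{Σ∧Σ∧} ⊆ ARO ⊆ ABP`) -/

section Deborder

variable {F : Type*} [Field F] {n : ℕ}

/-- **DDS21 Lemma 2.23 for `Σ∧Σ∧` (de-bordering: `\overline{Σ∧Σ∧} ⊆ ARO`), transfer form.** Over a
field `F` of characteristic zero: every `f ∈ \overline{Σ∧Σ∧(t,e,δ)}` (approximated over `F(ε)` by
`Σ∧Σ∧` circuits of top fan-in `≤ t`, exponents `≤ e`, univariate degrees `≤ δ`; the tree's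
`DDS2021.border` / t20's `DDS2021.swswClass`) is computed EXACTLY by a read-once oblivious ABP over
`F` of width `T = t · ((n+1)e + 1)` in the order `x_0, …, x_{n-1}`, with univariate edge labels of
degree `≤ e·δ`: `f = uᵀ M_0(x_0) ⋯ M_{n-1}(x_{n-1}) v`. "ARO of size `O(s n² D²)`" = this width times
`n + 1` layers. Route: §1's duality step over `F(ε)`, then B2b
`exists_transfer_of_isEpsApprox_sum_prod_univariate` (Nisan's characterisation; "the dimension of
the coefficient space does not increase under limits").
[cite: DuttaDwivediSaxena2022, Lemma 2.23 (full version p0025 L661–664)] -/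
theorem exists_transfer_of_mem_border_swswClass [CharZero F] {t e δ : ℕ} {f : MvPolynomial (Fin n) F}
    (hf : f ∈ border (swswClass (RatFunc F) n t e δ)) :
    ∃ (Cm : Fin n → Fin (e * δ + 1) →
        Matrix (Fin (t * ((n + 1) * e + 1))) (Fin (t * ((n + 1) * e + 1))) F)
      (u v : Fin (t * ((n + 1) * e + 1)) → F),
      f = (fun i => C (u i)) ⬝ᵥ ((List.ofFn fun ℓ : Fin n =>
          ∑ c : Fin (e * δ + 1), (X ℓ ^ (c : ℕ) : MvPolynomial (Fin n) F) •
            (Cm ℓ c).map (C : F →+* MvPolynomial (Fin n) F)).prod *ᵥ fun j => C (v j)) := by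
  classical
  obtain ⟨g, hg, hfg⟩ := hf
  obtain ⟨κ, G, hG, hgsum⟩ := exists_sum_prod_univariate_of_mem_swswClass hg
  set eqv := (finProdFinEquiv : Fin t × Fin ((n + 1) * e + 1) ≃ Fin (t * ((n + 1) * e + 1)))
    with heqv
  have hgsum' : g = ∑ q : Fin (t * ((n + 1) * e + 1)), C (κ (eqv.symm q)) *
      ∏ m, Polynomial.aeval (X m : MvPolynomial (Fin n) (RatFunc F)) (G (eqv.symm q) m) := by
    rw [hgsum]
    exact Fintype.sum_equiv eqv _ _ fun q => by rw [Equiv.symm_apply_apply]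
  rw [hgsum'] at hfg
  exact exists_transfer_of_isEpsApprox_sum_prod_univariate (fun q => κ (eqv.symm q))
    (fun q => G (eqv.symm q)) (fun q m => hG _ m) hfg

/-- ★ **DDS21 Lemma 2.23 for `Σ∧Σ∧` in the tree's ABP currency: `\overline{Σ∧Σ∧} ⊆ ABP`.** Over a
field `F` of characteristic zero, every `f ∈ border (swswClass (RatFunc F) n t e δ)` — a limit of
`Σ∧Σ∧(t, e, δ)` circuits over `F(ε)` — is computed EXACTLY by a layered ABP with univariate labels
over `F`, `DDS2021.UABPComputes ((n+1) · t((n+1)e+1) + e·δ + 2) f` (print: "an ARO of size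
`O(s n² D²)`"; here `n + 1` layers of width `t((n+1)e+1)` plus source and sink, labels of degree
`≤ e·δ ≤ D`). §1's duality step over `F(ε)` then B2b's `uabpComputes_of_isEpsApprox_sum_prod_univariate`
BY NAME. This is the `Σ∧Σ∧/Σ∧Σ∧` half of the base step of Thm. 5.1 (p0044 L1155–1158); Thm. 5.1
itself (`DDS2021_thm_5_1`) is NOT proved here.
[cite: DuttaDwivediSaxena2022, Lemma 2.23 (full version p0025 L661–664); Thm. 5.1 proof sketch (p0044 L1155–1158)] -/
theorem uabpComputes_of_mem_border_swswClass [CharZero F] {t e δ : ℕ} {f : MvPolynomial (Fin n) F}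
    (hf : f ∈ border (swswClass (RatFunc F) n t e δ)) :
    UABPComputes ((n + 1) * (t * ((n + 1) * e + 1)) + e * δ + 2) f := by
  classical
  obtain ⟨g, hg, hfg⟩ := hf
  obtain ⟨κ, G, hG, hgsum⟩ := exists_sum_prod_univariate_of_mem_swswClass hg
  set eqv := (finProdFinEquiv : Fin t × Fin ((n + 1) * e + 1) ≃ Fin (t * ((n + 1) * e + 1)))
    with heqv
  have hgsum' : g = ∑ q : Fin (t * ((n + 1) * e + 1)), C (κ (eqv.symm q)) *
      ∏ m, Polynomial.aeval (X m : MvPolynomial (Fin n) (RatFunc F)) (G (eqv.symm q) m) := by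
    rw [hgsum]
    exact Fintype.sum_equiv eqv _ _ fun q => by rw [Equiv.symm_apply_apply]
  rw [hgsum'] at hfg
  exact uabpComputes_of_isEpsApprox_sum_prod_univariate (fun q => κ (eqv.symm q))
    (fun q => G (eqv.symm q)) (fun q m => hG _ m) hfg

/-- **`\overline{Σ∧Σ∧} ⊆ ABP` with the LENGTH kept** (for the degree bookkeeping of DiDIL):
`f ∈ border (swswClass (RatFunc F) n t e δ) ⇒ UABPComputesLen ((n+1)·t((n+1)e+1) + e·δ + 2) (n+2) f`.
[cite: DuttaDwivediSaxena2022, Lemma 2.23 (full version p0025 L661–664)] -/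
theorem uabpComputesLen_of_mem_border_swswClass [CharZero F] {t e δ : ℕ}
    {f : MvPolynomial (Fin n) F} (hf : f ∈ border (swswClass (RatFunc F) n t e δ)) :
    UABPComputesLen ((n + 1) * (t * ((n + 1) * e + 1)) + e * δ + 2) (n + 2) f := by
  classical
  obtain ⟨g, hg, hfg⟩ := hf
  obtain ⟨κ, G, hG, hgsum⟩ := exists_sum_prod_univariate_of_mem_swswClass hg
  set eqv := (finProdFinEquiv : Fin t × Fin ((n + 1) * e + 1) ≃ Fin (t * ((n + 1) * e + 1)))
    with heqv
  have hgsum' : g = ∑ q : Fin (t * ((n + 1) * e + 1)), C (κ (eqv.symm q)) *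
      ∏ m, Polynomial.aeval (X m : MvPolynomial (Fin n) (RatFunc F)) (G (eqv.symm q) m) := by
    rw [hgsum]
    exact Fintype.sum_equiv eqv _ _ fun q => by rw [Equiv.symm_apply_apply]
  rw [hgsum'] at hfg
  exact uabpComputesLen_of_isEpsApprox_sum_prod_univariate (fun q => κ (eqv.symm q))
    (fun q => G (eqv.symm q)) (fun q m => hG _ m) hfg

/-- Budget arithmetic for the one-parameter forms: `(n+1)·t·((n+1)e+1) + e·δ + 2 ≤ s⁷` when
`t, e, δ, n ≤ s` and `2 ≤ s`. [folklore] -/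
private theorem swsw_budget_le_pow {t e δ n s : ℕ} (ht : t ≤ s) (he : e ≤ s) (hδ : δ ≤ s)
    (hn : n ≤ s) (hs : 2 ≤ s) :
    (n + 1) * (t * ((n + 1) * e + 1)) + e * δ + 2 ≤ s ^ 7 := by
  have hn1 : n + 1 ≤ 2 * s := by omega
  have h1 : (n + 1) * (t * ((n + 1) * e + 1)) ≤ 2 * s * (s * (2 * s * s + 1)) :=
    Nat.mul_le_mul hn1 (Nat.mul_le_mul ht (Nat.succ_le_succ (Nat.mul_le_mul hn1 he)))
  have h2 : 2 * s * (s * (2 * s * s + 1)) = 4 * (s * s * (s * s)) + 2 * (s * s) := by ring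
  have h3 : e * δ ≤ s * s := Nat.mul_le_mul he hδ
  have hp2 : 4 ≤ s * s := Nat.mul_le_mul hs hs
  have hp4 : 4 * (s * s) ≤ s * s * (s * s) := Nat.mul_le_mul_right (s * s) hp2
  have h8 : 8 * (s * s * (s * s)) ≤ s ^ 7 :=
    calc 8 * (s * s * (s * s)) ≤ s * s * s * (s * s * (s * s)) :=
          Nat.mul_le_mul_right _ (Nat.mul_le_mul hp2 hs)
      _ = s ^ 7 := by ring
  omega

/-- One-parameter form of `\overline{Σ∧Σ∧} ⊆ ABP` ("ARO of size `O(s n² D²)`", Lemma 2.23), in the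
binder shape of the tree's `DDS2021_thm_5_1` (`t, e, δ, n ≤ s`, `2 ≤ s`):
`f ∈ border (swswClass (RatFunc F) n t e δ) ⇒ UABPComputesLen (s⁷) (n+2) f`
(`(n+1)·t·((n+1)e+1) + e·δ + 2 ≤ 4s⁴ + 3s² + 2 ≤ 8s⁴ ≤ s⁷`; crude, the exponent is immaterial).
[cite: DuttaDwivediSaxena2022, Lemma 2.23 (full version p0025 L661–664)] -/
theorem uabpComputesLen_of_mem_border_swswClass_le [CharZero F] {t e δ s : ℕ}
    {f : MvPolynomial (Fin n) F} (hf : f ∈ border (swswClass (RatFunc F) n t e δ))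
    (ht : t ≤ s) (he : e ≤ s) (hδ : δ ≤ s) (hn : n ≤ s) (hs : 2 ≤ s) :
    UABPComputesLen (s ^ 7) (n + 2) f :=
  (uabpComputesLen_of_mem_border_swswClass hf).mono (swsw_budget_le_pow ht he hδ hn hs)

/-- One-parameter form without the length. [cite: DuttaDwivediSaxena2022, Lemma 2.23 (full version p0025 L661–664)] -/
theorem uabpComputes_of_mem_border_swswClass_le [CharZero F] {t e δ s : ℕ}
    {f : MvPolynomial (Fin n) F} (hf : f ∈ border (swswClass (RatFunc F) n t e δ))
    (ht : t ≤ s) (he : e ≤ s) (hδ : δ ≤ s) (hn : n ≤ s) (hs : 2 ≤ s) :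
    UABPComputes (s ^ 7) f :=
  (uabpComputesLen_of_mem_border_swswClass_le hf ht he hδ hn hs).uabpComputes

end Deborder

/-! ### `Σ∧Σ∧ ⊆ ABP` directly (exact members; no duality, every field) -/

section Direct

variable {K : Type*} [Field K] {n : ℕ}

/-- `X m` involves at most one variable (also over the trivial ring). [folklore] -/
private theorem card_vars_aeval_X_le_one (m : Fin n) (q : Polynomial K) :
    (Polynomial.aeval (X m : MvPolynomial (Fin n) K) q).vars.card ≤ 1 :=
  (Finset.card_le_card (vars_aeval_X_subset m q)).trans (Finset.card_singleton m).le

/-- **A `Σ∧` form has a small ABP**: `a + ∑_{m<n} p_m(x_m)` with `deg p_m ≤ δ` is the parallel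
composition of the `n + 1` one-edge programs with labels `C a`, `p_m(x_m)` — budget
`(n+1)·(δ+2) + 2`, length `3` (DDS Def. 2.5: univariate edge labels).
[cite: DuttaDwivediSaxena2022, Def. 2.5 and §2.1 remark (full version p0017 L468 – p0018 L478); Lemma 2.17 (p0022 L597)] -/
theorem UABPComputesLen.of_wedgeForm {δ : ℕ} (a : K) {p : Fin n → Polynomial K}
    (hp : ∀ m, (p m).natDegree ≤ δ) :
    UABPComputesLen ((n + 1) * (δ + 2) + 2) 3 (wedgeForm a p) := by
  classical
  let g : Option (Fin n) → MvPolynomial (Fin n) K := fun o =>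
    Option.elim o (C a) fun m => Polynomial.aeval (X m : MvPolynomial (Fin n) K) (p m)
  have hg : ∀ o, UABPComputesLen (δ + 2) 1 (g o) := by
    rintro (_ | m)
    · exact UABPComputesLen.of_C (by omega) a
    · exact UABPComputesLen.of_label (by omega) _ (card_vars_aeval_X_le_one m (p m))
        ((totalDegree_aeval_X_le m (hp m)).trans (by omega))
  have h := UABPComputesLen.sum g hg
  rw [Fintype.card_option, Fintype.card_fin, Fintype.sum_option] at h
  simpa [g, wedgeForm_eq] using h

/-- **`Σ∧Σ∧` circuits have small ABPs**, directly (no duality detour, every field): each term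
`c · g^{e_i}` is `of_wedgeForm → pow → smul_C`, the `t` terms (of unequal lengths, `e_i ≤ e`) are
summed by `sum_le`; budget `t · (e·((n+1)(δ+2)+2) + 4e + 7) + 2`, length `4e + 5`. (For the BORDER
the route through Lemma 2.23 above is needed; this is the plain containment `Σ∧Σ∧ ⊆ ABP`.)
[cite: DuttaDwivediSaxena2022, §2.3 (full version p0020 L537–540, p0022 L593–596) with §2.1 remark after Def. 2.5 (p0018 L477–478)] -/
theorem UABPComputesLen.of_mem_swswClass {t e δ : ℕ} {f : MvPolynomial (Fin n) K}
    (hf : f ∈ swswClass K n t e δ) :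
    UABPComputesLen (t * ((e * ((n + 1) * (δ + 2) + 2) + 4) + (e * 4 + 3)) + 2) (e * 4 + 3 + 2) f := by
  classical
  obtain ⟨c, a, p, ex, hex, hp, rfl⟩ := hf
  have h := UABPComputesLen.sum_le (S := e * ((n + 1) * (δ + 2) + 2) + 4) (Lmax := e * 4 + 3)
    (fun i : Fin t => (C (c i) * wedgeForm (a i) (p i) ^ ex i : MvPolynomial (Fin n) K))
    (fun i => 1 + ex i * (3 + 1) + 2)
    (fun i => by have := hex i; omega) fun i => by
      have h := ((UABPComputesLen.of_wedgeForm (a i) (hp i)).pow (ex i)).smul_C (c i)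
      refine h.mono ?_
      have := Nat.mul_le_mul_right ((n + 1) * (δ + 2) + 2) (hex i)
      omega
  simpa [Fintype.card_fin] using h

/-- `Σ∧Σ∧ ⊆ ABP` in the tree's currency (exact members, every field).
[cite: DuttaDwivediSaxena2022, §2.3 (full version p0020 L537–540, p0022 L593–596) with §2.1 remark after Def. 2.5 (p0018 L477–478)] -/
theorem uabpComputes_of_mem_swswClass {t e δ : ℕ} {f : MvPolynomial (Fin n) K}
    (hf : f ∈ swswClass K n t e δ) :
    UABPComputes (t * ((e * ((n + 1) * (δ + 2) + 2) + 4) + (e * 4 + 3)) + 2) f :=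
  (UABPComputesLen.of_mem_swswClass hf).uabpComputes

end Direct

/-! ## §3 The `k = 1` base of Thm. 5.1: `\overline{ΠΣ∧} = ΠΣ∧ ⊆ ABP` -/

section BaseCase

variable {K : Type*} [Field K] {n : ℕ}

/-- **`Σ^{[k]}ΠΣ∧` circuits have small ABPs**: `f ∈ spswClass K n k d e` (sums of `k` products of
`d` `Σ∧` forms with univariates of degree `≤ e`) ⇒ an ABP within budget
`k · (2 + d · ((n+1)(e+2) + 2)) + 2`, of length `4 d + 3` (sum of `k` products of `d` `Σ∧`-form
programs, `UABPComputesLen.of_wedgeForm`).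
[cite: DuttaDwivediSaxena2022, §5 Thm. 5.1 proof sketch, base case (full version p0044 L1155–1158); §2.1 remark after Def. 2.5 (p0018 L477–478)] -/
theorem UABPComputesLen.of_mem_spswClass {k d e : ℕ} {f : MvPolynomial (Fin n) K}
    (hf : f ∈ spswClass K n k d e) :
    UABPComputesLen (k * (2 + d * ((n + 1) * (e + 2) + 2)) + 2) (1 + d * (3 + 1) + 2) f := by
  classical
  obtain ⟨c, p, hp, rfl⟩ := hf
  have hprod : ∀ i : Fin k, UABPComputesLen (2 + d * ((n + 1) * (e + 2) + 2)) (1 + d * (3 + 1))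
      (∏ j : Fin d, (C (c i j) + ∑ m : Fin n,
        Polynomial.aeval (X m : MvPolynomial (Fin n) K) (p i j m))) := fun i => by
    have h := UABPComputesLen.prod
      (fun j : Fin d => (C (c i j) + ∑ m : Fin n,
        Polynomial.aeval (X m : MvPolynomial (Fin n) K) (p i j m) : MvPolynomial (Fin n) K))
      Finset.univ (fun j _ => by
        rw [← wedgeForm_eq]
        exact UABPComputesLen.of_wedgeForm (c i j) (hp i j))
    simpa [Finset.card_univ, Fintype.card_fin] using h
  have h := UABPComputesLen.sum _ hprod
  simpa [Fintype.card_fin] using h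

/-- `Σ^{[k]}ΠΣ∧ ⊆ ABP` in the tree's currency (exact members, every field).
[cite: DuttaDwivediSaxena2022, §5 Thm. 5.1 proof sketch, base case (full version p0044 L1155–1158)] -/
theorem uabpComputes_of_mem_spswClass {k d e : ℕ} {f : MvPolynomial (Fin n) K}
    (hf : f ∈ spswClass K n k d e) :
    UABPComputes (k * (2 + d * ((n + 1) * (e + 2) + 2)) + 2) f :=
  (UABPComputesLen.of_mem_spswClass hf).uabpComputes

/-- ★ **The `k = 1` case of DDS Thm. 5.1, PROVED** (explicit exponent `6` for the unnamed constant of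
`DDS2021_thm_5_1` at `k = 1`): a polynomial approximated by `ΠΣ∧` circuits (one product of `d` sums
of univariates of degree `≤ e`) over `F(ε)` within a budget `s ≥ 2` dominating `d`, `e`, `n` is
computed exactly by an ABP with univariate labels within budget `s⁶` — "`\overline{ΠΣ∧} = ΠΣ∧`"
(Lemma 2.21, the tree's `DDS2021_lemma_2_21_holds`, `DDS21DeborderPiSigmaWedgeProofs.lean`) "and
trivially it has a small ABP" (`uabpComputes_of_mem_spswClass`). Base of the DiDIL induction of §5
only; `DDS2021_thm_5_1` itself (all `k`) is NOT proved here.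
[cite: DuttaDwivediSaxena2022, Thm. 5.1 and its proof sketch, `k = 1` (full version p0043 L1148–1150, p0044 L1155–1158); Lemma 2.21 (p0024 L633–640)] -/
theorem uabpComputes_of_mem_border_spswClass_one (F : Type) [Field F] [CharZero F] (n d e s : ℕ)
    (f : MvPolynomial (Fin n) F) (hds : d ≤ s) (hes : e ≤ s) (hns : n ≤ s) (hs : 2 ≤ s)
    (hf : f ∈ border (spswClass (RatFunc F) n 1 d e)) : UABPComputes (s ^ 6) f := by
  have h1 : f ∈ spswClass F n 1 d e := DDS2021_lemma_2_21_holds F n d e f hf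
  refine (uabpComputes_of_mem_spswClass h1).mono ?_
  have h2 : d * ((n + 1) * (e + 2) + 2) ≤ s * ((s + 1) * (s + 2) + 2) :=
    Nat.mul_le_mul hds (by nlinarith)
  have h3 : s * ((s + 1) * (s + 2) + 2) + 4 ≤ s ^ 6 := by
    have hs2 : 4 ≤ s * s := by nlinarith
    calc s * ((s + 1) * (s + 2) + 2) + 4 = s * s * s + 3 * (s * s) + 4 * s + 4 := by ring
      _ ≤ s * s * s + 3 * (s * s) + 2 * (s * s) + (s * s) := by nlinarith
      _ = s * s * s + 6 * (s * s) := by ring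
      _ ≤ s * s * s + 3 * (s * s * s) := by nlinarith
      _ = 4 * (s * s * s) := by ring
      _ ≤ (s * s * s) * (s * s * s) := by
          have : 4 ≤ s * s * s := by nlinarith
          exact Nat.mul_le_mul_right _ this
      _ = s ^ 6 := by ring
  omega

end BaseCase

end DDS2021

end Literature.Computability.AlgebraicComplexity

end
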